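import Mathlib
import Summits.Ventures.PercRepro2.K5HyperCoeffsI
import Summits.Ventures.PercRepro2.K5HyperTheoremI
import Summits.Ventures.PercRepro2.K5HyperCertT1
import Summits.Ventures.PercRepro2.K5HyperCertT2

/-!
# THE (ii)-SIDE HYPEREDGE BASE TERMS `N(H + T(1)) ≥ 0`, `N(H + T(2)) ≥ 0` AT EVERY `K₅` PROFILE
(blind cell PercRepro2, typer-1 g10; mine-1 §23.1 — the base terms of the degree-3 star identities in the
(ii) line, «paper theorems by §21», now kernel theorems on `K₅`)

From the certificates `K5HyperCertT1.lean` / `K5HyperCertT2.lean` through the generic coefficient sums of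
`K5HyperCoeffsI.lean` and the dictionary of `K5HyperTheorem.lean`:

* **`cT1_le`**, **`cT2_le`**: the coefficient inequalities `csumT1 cNegOn D k ≤ csumT1 cPosOn D k`, …;
* **`T1_nonneg_real`**, **`T2_nonneg_real`**: `0 ≤ N(H + T(1))`, `0 ≤ N(H + T(2))` as profile sums of p1's `KII`,
  every triangle of marks, every profile.
-/

namespace Summit.Ventures.PercRepro2

namespace K5

section BaseII

/-- **`N(H + D(1)) ≥ 0` at every `K₅` profile**, from its certificate. -/
theorem cT1_le (D : Fin 10 → Bool) (hc : CertLE (sumT1 negOn D) (sumT1 posOn D)) (k : Fin 10 → Fin 4) :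
    csumT1 cNegOn D k ≤ csumT1 cPosOn D k :=
  le_of_certLE (csumT1 cPosOn D) (csumT1 cNegOn D)
    (fun k => by rw [KB3_val]; have := csumT1_le cPosOn (2 * 59049) cPosOn_le D k; omega)
    (fun k => by rw [KB3_val]; have := csumT1_le cNegOn (2 * 59049) cNegOn_le D k; omega)
    (sumT1_eq cPosOn posOn posOn_eq D) (sumT1_eq cNegOn negOn negOn_eq D) hc k

/-- **`N(H + D(2)) ≥ 0` at every `K₅` profile**, from its certificate. -/
theorem cT2_le (D : Fin 10 → Bool) (hc : CertLE (sumT2 negOn D) (sumT2 posOn D)) (k : Fin 10 → Fin 4) :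
    csumT2 cNegOn D k ≤ csumT2 cPosOn D k :=
  le_of_certLE (csumT2 cPosOn D) (csumT2 cNegOn D)
    (fun k => by rw [KB3_val]; have := csumT2_le cPosOn (2 * 59049) cPosOn_le D k; omega)
    (fun k => by rw [KB3_val]; have := csumT2_le cNegOn (2 * 59049) cNegOn_le D k; omega)
    (sumT2_eq cPosOn posOn posOn_eq D) (sumT2_eq cNegOn negOn negOn_eq D) hc k

variable {R : Type*} [Field R] [LinearOrder R] [IsStrictOrderedRing R]

/-- `N(H + D(2))` for the (ii) kernel. -/
noncomputable def NT2 (D : Fin 10 → Bool) (k : Fin 10 → Fin 4) : R := rsumT2 (fun S₁ S₂ S₃ => NOn S₁ S₂ S₃ k) D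

omit [LinearOrder R] [IsStrictOrderedRing R] in
/-- `N(H + D(1))` as generic coefficient sums. -/
lemma NT1_eq' (D : Fin 10 → Bool) (k : Fin 10 → Fin 4) :
    NT1 (R := R) D k = ((csumT1 cPosOn D k : ℕ) : R) - ((csumT1 cNegOn D k : ℕ) : R) := by
  unfold NT1 csumT1
  simp only [NOn_eq]
  push_cast
  ring

omit [LinearOrder R] [IsStrictOrderedRing R] in
/-- `N(H + D(2)) = csumT2 cPosOn − csumT2 cNegOn`. -/
lemma NT2_eq (D : Fin 10 → Bool) (k : Fin 10 → Fin 4) :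
    NT2 (R := R) D k = ((csumT2 cPosOn D k : ℕ) : R) - ((csumT2 cNegOn D k : ℕ) : R) := by
  unfold NT2 rsumT2 csumT2
  simp only [NOn_eq]
  push_cast
  ring

/-- **`0 ≤ N(H + D(1))`** from the certificate. -/
theorem T1_real (D : Fin 10 → Bool) (hc : CertLE (sumT1 negOn D) (sumT1 posOn D)) (k : Fin 10 → Fin 4) :
    0 ≤ NT1 (R := R) D k := by
  rw [NT1_eq', sub_nonneg]
  exact_mod_cast cT1_le D hc k

/-- **`0 ≤ N(H + D(2))`** from the certificate. -/
theorem T2_real (D : Fin 10 → Bool) (hc : CertLE (sumT2 negOn D) (sumT2 posOn D)) (k : Fin 10 → Fin 4) :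
    0 ≤ NT2 (R := R) D k := by
  rw [NT2_eq, sub_nonneg]
  exact_mod_cast cT2_le D hc k

/-- **The `N(H + T(1)) ≥ 0` certificate of every triangle of marks.** -/
theorem certT1 (a b c : ℕ) (hab : a < b) (hbc : b < c) (hc : c < 5) :
    CertLE (sumT1 negOn (triMask a b c)) (sumT1 posOn (triMask a b c)) := by
  interval_cases c <;> interval_cases b <;> interval_cases a
  · exact cert_T1_012
  · exact cert_T1_013
  · exact cert_T1_023
  · exact cert_T1_123
  · exact cert_T1_014
  · exact cert_T1_024
  · exact cert_T1_124
  · exact cert_T1_034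
  · exact cert_T1_134
  · exact cert_T1_234

/-- **The `N(H + T(2)) ≥ 0` certificate of every triangle of marks.** -/
theorem certT2 (a b c : ℕ) (hab : a < b) (hbc : b < c) (hc : c < 5) :
    CertLE (sumT2 negOn (triMask a b c)) (sumT2 posOn (triMask a b c)) := by
  interval_cases c <;> interval_cases b <;> interval_cases a
  · exact cert_T2_012
  · exact cert_T2_013
  · exact cert_T2_023
  · exact cert_T2_123
  · exact cert_T2_014
  · exact cert_T2_024
  · exact cert_T2_124
  · exact cert_T2_034
  · exact cert_T2_134
  · exact cert_T2_234

/-- **`0 ≤ N(H + T(1))`** as a profile sum of `KII`, every triangle, every profile. -/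
theorem T1_nonneg_real (a b c : ℕ) (hab : a < b) (hbc : b < c) (hc : c < 5) (k : Fin 10 → Fin 4) :
    0 ≤ NT1 (R := R) (triMask a b c) k :=
  T1_real _ (certT1 a b c hab hbc hc) k

/-- **`0 ≤ N(H + T(2))`** as a profile sum of `KII`, every triangle, every profile. -/
theorem T2_nonneg_real (a b c : ℕ) (hab : a < b) (hbc : b < c) (hc : c < 5) (k : Fin 10 → Fin 4) :
    0 ≤ NT2 (R := R) (triMask a b c) k :=
  T2_real _ (certT2 a b c hab hbc hc) k

end BaseII

end K5

end Summit.Ventures.PercRepro2
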